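import Literature.MathematicalPhysics.QuantumFieldTheory.Balaban1983to89.B11Eq90Transpose

/-!
# `Balaban1983to89.B11Eq90Pullback` — T. Bałaban, *The variational problem and background fields in renormalization group method for lattice gauge theories*, Commun. Math. Phys. **102** (1985) 277–309 [Balaban1985Variational]: (63) p. 287, (90) p. 291, (98) p. 293 — THE PULLBACK `(Φ′(A′))ᵗ cur(Φ A′)` OF A (63)-CURRENT ALONG A MAP OF THE SPACE (115): the shape of (90) («… − 𝔇*(A′)H* …», `(Φ′)ᵗ = 1 − 𝔇*(A′)H*` for `Φ` = (47)), its CHAIN-RULE CERTIFICATE (the pullback of the (63)-current of `F` is the (63)-current of `F ∘ Φ`), its differentiability and its (98)-form slot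

statement-level skeleton of published theorems with citation tags; proofs where landed; nothing here is a claim about the Yang–Mills mass gap

PDF held: `paper:balaban1985-cmp102-variational-background` (journal page = PDF page + 276); pp. 287, 290–293 read from the `lit read` text layer
by this seat (2026-08-21).

CITATION HEADER (lean-in-tree rule 2026-08-18).  WHAT IS REPRODUCED: the composition step common to the five groups (85)–(96) of
`W = (δ/δA′)V` (rows `B11.Eq85`/`B11.Prop4` of r08's `ROWS-B11.md`): a (63)-current read at `A = Φ(A′)` is carried back to `A′` by the transpose
of `Φ′(A′)` (`B11Eq90Transpose.transCur`).  THE PRINT, verbatim.  p. 287 (63): *«⟨(δ/δA′)D(A′), δA′⟩ = (d/dτ)D(A′ + τδA′)|_{τ=0}.»*; p. 291 (90):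
*«(δ/δA′(b))V′₀(A′ − HD(A′)) = Σ_{p∈st(b)}((∂/∂A(b))V′₀)(A′ − HD(A′), ∂p) − 𝔇*(A′)H*Σ_{p∈st(·)}((∂/∂A(·))V′₀)(A′ − HD(A′), ∂p)»*; p. 293
(98): *«|((δ/δA′)V)(A′)|₍₋₃₎ ≦ C₄(max{|A′|₍₋₁₎, |∇A′|₍₋₂₎})²»*; p. 292: *«The functional derivative of V(A′) is an analytic function on this space»*.

WHAT IS DEFINED AND PROVED (sorry-free; axioms standard; one def with body; no `Prop`-valued definition, no new named fact).
`transCur_comp` (`(M ∘ N)ᵗ = Nᵗ ∘ Mᵗ`, §0); **`pullCur ρ τ Φ cur A′ := transCur ρ τ (fderiv ℂ Φ A′) (cur (Φ A′))`**; `differentiableOn_transCur_apply` (`A′ ↦ (M(A′))ᵗK(A′)` differentiable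
for differentiable families); **`pair27_pullCur`** — if `⟨cur(Φ A′), δ⟩ = (d/dt)F(Φ A′ + tδ)|₀` for all
`δ`, `Φ` differentiable at `A′` and `F` at `Φ A′`, then `⟨pullCur Φ cur A′, δ⟩ = (d/dt)F(Φ(A′ + tδ))|₀`; **`differentiableOn_pullCur`** (`Φ` analytic
on `s`, `cur` differentiable on `t ⊇ Φ(s)`; the transposition enters as the continuous linear `transCurL`, the two instance paths to the topology of
a space of operators being definitionally equal); `norm_pullCur_le`; **`norm_pullCur_le_sq`** (`‖cur Y‖ ≤ C‖Y‖²` on `‖Y‖ < R`, `Φ(ball R′) ⊆ ball R`,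
`‖Φ A′‖ ≤ ℓ‖A′‖`, kernel columns of `Φ′(A′)` bounded by `Θ` ⇒ `‖pullCur Φ cur A′‖₍₋₃₎ ≤ ‖ρ‖‖τ‖ΘCℓ²‖A′‖²`); **`prop4Hyp_pullCur`** (the
`B11Prop6Scheme.Prop4Hyp` slot of the pulled-back group).

HONEST SCOPE — what is NOT claimed.  [folklore] chain rule + the transpose bookkeeping of `B11Eq90Transpose`; the column letter `Θ` is where
print's kernel bounds (46), (73) enter (DISPLAYED by consumers; no uniformity claimed); `ρ`, `τ` letters with `τ(ρ(ℓ)X) = ℓ X`.  Instantiated at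
(47) and the V₀-current in the sequel `B11Eq90V0GroupComposed`.  NOT summit progress (cell pub-balaban: NE9 NOT PRINTED / NOT PROVED; spine PROVED
0/9; HONEST DEPENDENCY: continuum YM on T⁴ ⇐ BetaPertH ∧ nine spine estimates (0/9 proved); BetaPertH ⇐ (D1) ∧ (D4) ∧ CAP+tail; G-an2-4 gates
asym, D1 and NE2/3/4).  Unit `b2b-balaban-t4-ne9-formalise-leaf-05` (NE9 crux-team leaf prover, gen 65).  Imports `B11Eq90Transpose` ONLY.
-/

noncomputable section

open NormedSpace Complex Metric Set Finset Filter Topology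

namespace Literature.MathematicalPhysics.QuantumFieldTheory.Balaban1983to89.B11Eq90Pullback

open Literature.MathematicalPhysics.QuantumFieldTheory.Balaban1983to89.B11Eq90V0primeCurrent (curL curL_apply flat115 flat115_apply)
open Literature.MathematicalPhysics.QuantumFieldTheory.Balaban1983to89.B11Eq90V0Derivative (deriv_line_eq_fderiv)
open Literature.MathematicalPhysics.QuantumFieldTheory.Balaban1983to89.B11Eq90Transpose
open B9SectCLatticeCarrier (Bond)
open B4Sect5Torus (TSite)
open B11Eq115Space

variable {𝔸 : Type*} [NormedRing 𝔸] [NormedAlgebra ℂ 𝔸]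
variable {d : ℕ} {Pd : Fin d → ℕ} {L η : ℝ} {lev₀ : Bond d Pd → ℕ} {κ' : Type*} {lev₁ : κ' → ℕ}
  {Dc : (Bond d Pd → 𝔸) →ₗ[ℂ] (κ' → 𝔸)}

/-! ## §0 Contravariant functoriality of the transpose: `(M ∘ N)ᵗ = Nᵗ ∘ Mᵗ` (print's `𝔇*(A′)H*` is a product of two transposes) -/

section Functorial

variable [Fact (0 < L)] [Fact (0 < η)] [Fintype κ'] [FiniteDimensional ℂ 𝔸]

/-- **`(M ∘ N)ᵗ = Nᵗ ∘ Mᵗ`** for the (27)-transpose, given only the dualising identity `τ(ρ(ℓ)X) = ℓ X` (so print's `𝔇*(A′)H* = (H𝔇(A′))*`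
may be read factor by factor; X-read C-ne9leaf06g55-4 INFO-1). [cite: Balaban1985Variational, (88)–(90) p.291] -/
theorem transCur_comp (ρ : (𝔸 →L[ℂ] ℂ) →L[ℂ] 𝔸) (τ : 𝔸 →L[ℂ] ℂ) (hρ : ∀ (ℓ : 𝔸 →L[ℂ] ℂ) (X : 𝔸), τ (ρ ℓ * X) = ℓ X)
    (M N : Space115 L η lev₀ lev₁ Dc →L[ℂ] Space115 L η lev₀ lev₁ Dc) (K : NegSize L η lev₀ 3 𝔸) :
    transCur ρ τ (M.comp N) K = transCur ρ τ N (transCur ρ τ M K) := by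
  apply (NegSup.equiv (levWeight L η lev₀ 3) 𝔸).injective
  funext b
  rw [transCur_apply, transCur_apply]
  congr 1
  ext X
  rw [colFun_apply, colFun_apply]
  simp only [transCur_apply, hρ, colFun_apply, ContinuousLinearMap.comp_apply]
  -- `M (N δ_b X) = Σ_{b′} M (δ_{b′} (N δ_b X)(b′))`
  conv_lhs => rw [← sum_single115 (lev₁ := lev₁) (Dc := Dc) (N (single115 b X)), map_sum, map_sum]
  simp only [Finset.sum_apply, Finset.mul_sum, map_sum]
  rw [Finset.sum_comm]

end Functorial

/-! ## §1 The pullback of a current along a map of the space (115): `(Φ′(A′))ᵗ(cur(Φ(A′)))` — the shape of (90) -/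

section Pullback

variable [Fact (0 < L)] [Fact (0 < η)] [Fintype κ'] [FiniteDimensional ℂ 𝔸]

/-- **THE PULLBACK OF A CURRENT ALONG A MAP** `Φ` of the space (115): `A′ ↦ (Φ′(A′))ᵗ(cur(Φ A′))` — for `Φ` = the Sect. C map (47)
`A′ ↦ A = A′ − HD(A′)` (so `Φ′(A′) = 1 − H𝔇(A′)`, `(Φ′(A′))ᵗ = 1 − 𝔇*(A′)H*`) and `cur` = a current read at `A`, this is EXACTLY the shape of
(90): `Σ_{p∈st(b)}(∂/∂A(b))V′₀(A′ − HD(A′), ∂p) − 𝔇*(A′)H*Σ_{p∈st(·)}(∂/∂A(·))V′₀(A′ − HD(A′), ∂p)`.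
[cite: Balaban1985Variational, (90) p.291, (47) p.285] -/
def pullCur (ρ : (𝔸 →L[ℂ] ℂ) →L[ℂ] 𝔸) (τ : 𝔸 →L[ℂ] ℂ) (Φ : Space115 L η lev₀ lev₁ Dc → Space115 L η lev₀ lev₁ Dc)
    (cur : Space115 L η lev₀ lev₁ Dc → NegSize L η lev₀ 3 𝔸) (A' : Space115 L η lev₀ lev₁ Dc) : NegSize L η lev₀ 3 𝔸 :=
  transCur ρ τ (fderiv ℂ Φ A') (cur (Φ A'))

/-- Unfolding the pullback through `transCurL`. [cite: Balaban1985Variational, (90) p.291] -/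
theorem pullCur_eq (ρ : (𝔸 →L[ℂ] ℂ) →L[ℂ] 𝔸) (τ : 𝔸 →L[ℂ] ℂ) (Φ : Space115 L η lev₀ lev₁ Dc → Space115 L η lev₀ lev₁ Dc)
    (cur : Space115 L η lev₀ lev₁ Dc → NegSize L η lev₀ 3 𝔸) :
    pullCur ρ τ Φ cur = fun A' => transCurL ρ τ (fderiv ℂ Φ A') (cur (Φ A')) := rfl

/-- **THE CHAIN RULE THROUGH THE PAIRING — (63) FOR A COMPOSED FUNCTIONAL**: if `cur` is the (63)-current of a functional `F` (`⟨cur(Y), δ⟩ =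
(d/dt)F(Y + tδ)|₀` for all `Y`, `δ`), `Φ` is differentiable at `A′` and `F` at `Φ(A′)`, then the pullback is the (63)-current of `F ∘ Φ`:
`⟨(Φ′(A′))ᵗcur(Φ A′), δ⟩ = (d/dt)F(Φ(A′ + tδ))|₀`. [cite: Balaban1985Variational, (63) p.287, (90) p.291] -/
theorem pair27_pullCur (ρ : (𝔸 →L[ℂ] ℂ) →L[ℂ] 𝔸) (τ : 𝔸 →L[ℂ] ℂ) (hρ : ∀ (ℓ : 𝔸 →L[ℂ] ℂ) (X : 𝔸), τ (ρ ℓ * X) = ℓ X)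
    {F : Space115 L η lev₀ lev₁ Dc → ℂ} {cur : Space115 L η lev₀ lev₁ Dc → NegSize L η lev₀ 3 𝔸}
    {Φ : Space115 L η lev₀ lev₁ Dc → Space115 L η lev₀ lev₁ Dc} {A' : Space115 L η lev₀ lev₁ Dc}
    (hcur : ∀ δ : Bond d Pd → 𝔸, pair27 τ (cur (Φ A')) δ
      = deriv (fun t : ℂ => F (Φ A' + t • (JetSup.equiv (levWeight L η lev₀ 1) (levWeight L η lev₁ 2) Dc).symm δ)) 0)
    (hΦ : DifferentiableAt ℂ Φ A') (hF : DifferentiableAt ℂ F (Φ A')) (δ : Bond d Pd → 𝔸) :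
    pair27 τ (pullCur ρ τ Φ cur A') δ
      = deriv (fun t : ℂ => F (Φ (A' + t • (JetSup.equiv (levWeight L η lev₀ 1) (levWeight L η lev₁ 2) Dc).symm δ))) 0 := by
  set δ' : Space115 L η lev₀ lev₁ Dc := (JetSup.equiv (levWeight L η lev₀ 1) (levWeight L η lev₁ 2) Dc).symm δ with hδ'
  rw [pullCur, pair27_transCur ρ τ hρ, hcur]
  have e1 : (JetSup.equiv (levWeight L η lev₀ 1) (levWeight L η lev₁ 2) Dc).symm (flat115 (fderiv ℂ Φ A' δ')) = fderiv ℂ Φ A' δ' := rfl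
  rw [e1, deriv_line_eq_fderiv hF]
  have e2 : (fun t : ℂ => F (Φ (A' + t • δ'))) = fun t : ℂ => (F ∘ Φ) (A' + t • δ') := rfl
  rw [e2, deriv_line_eq_fderiv (hF.comp A' hΦ), fderiv_comp A' hF hΦ]
  rfl

/-- **DIFFERENTIABILITY OF A TRANSPOSED FAMILY**: for differentiable families `A′ ↦ M(A′)` of operators of the space (115) and `A′ ↦ K(A′)`
of currents, `A′ ↦ (M(A′))ᵗ K(A′)` is differentiable (the transposition is the continuous linear `transCurL`; the two instance paths to the
topology of the operator space — its own and the one through its operator norm — agree definitionally and are reconciled explicitly).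
[cite: Balaban1985Variational, Prop. 4 p.292] -/
theorem differentiableOn_transCur_apply (ρ : (𝔸 →L[ℂ] ℂ) →L[ℂ] 𝔸) (τ : 𝔸 →L[ℂ] ℂ) {s : Set (Space115 L η lev₀ lev₁ Dc)}
    {M : Space115 L η lev₀ lev₁ Dc → (Space115 L η lev₀ lev₁ Dc →L[ℂ] Space115 L η lev₀ lev₁ Dc)}
    {K : Space115 L η lev₀ lev₁ Dc → NegSize L η lev₀ 3 𝔸} (hM : DifferentiableOn ℂ M s) (hK : DifferentiableOn ℂ K s) :
    DifferentiableOn ℂ (fun A' => transCur ρ τ (M A') (K A')) s := by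
  have hT : @Differentiable ℂ _ (Space115 L η lev₀ lev₁ Dc →L[ℂ] Space115 L η lev₀ lev₁ Dc) NormedAddCommGroup.toAddCommGroup
      NormedSpace.toModule UniformSpace.toTopologicalSpace (NegSize L η lev₀ 3 𝔸 →L[ℂ] NegSize L η lev₀ 3 𝔸)
      NormedAddCommGroup.toAddCommGroup NormedSpace.toModule UniformSpace.toTopologicalSpace
      (fun M => transCurL (lev₁ := lev₁) (Dc := Dc) ρ τ M) :=
    (transCurL (L := L) (η := η) (lev₀ := lev₀) (lev₁ := lev₁) (Dc := Dc) ρ τ).differentiable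
  have h3 : DifferentiableOn ℂ (fun A' => transCurL (lev₁ := lev₁) (Dc := Dc) ρ τ (M A')) s := hT.comp_differentiableOn hM
  exact h3.clm_apply hK

/-- **DIFFERENTIABILITY OF THE PULLBACK** (Prop. 4's «The functional derivative of V(A′) is an analytic function on this space» for a composed
group): `Φ` analytic on `s`, mapping `s` into `t`, `cur` differentiable on `t` ⇒ the pullback is differentiable on `s`.
[cite: Balaban1985Variational, Prop. 4 p.292] -/
theorem differentiableOn_pullCur (ρ : (𝔸 →L[ℂ] ℂ) →L[ℂ] 𝔸) (τ : 𝔸 →L[ℂ] ℂ) {Φ : Space115 L η lev₀ lev₁ Dc → Space115 L η lev₀ lev₁ Dc}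
    {cur : Space115 L η lev₀ lev₁ Dc → NegSize L η lev₀ 3 𝔸} {s t : Set (Space115 L η lev₀ lev₁ Dc)}
    (hΦ : AnalyticOnNhd ℂ Φ s) (hmaps : MapsTo Φ s t) (hcur : DifferentiableOn ℂ cur t) :
    DifferentiableOn ℂ (pullCur ρ τ Φ cur) s :=
  differentiableOn_transCur_apply ρ τ hΦ.fderiv.differentiableOn (hcur.comp hΦ.differentiableOn hmaps)

/-- **THE `|·|_{(−3)}` BOUND OF THE PULLBACK**: `‖(Φ′(A′))ᵗcur(Φ A′)‖₍₋₃₎ ≤ ‖ρ‖‖τ‖·Θ·‖cur(Φ A′)‖₍₋₃₎`, `Θ` a weighted-column bound of the kernel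
of `Φ′(A′)`. [cite: Balaban1985Variational, (90) p.291, (86) p.291] -/
theorem norm_pullCur_le (ρ : (𝔸 →L[ℂ] ℂ) →L[ℂ] 𝔸) (τ : 𝔸 →L[ℂ] ℂ) {Φ : Space115 L η lev₀ lev₁ Dc → Space115 L η lev₀ lev₁ Dc}
    {cur : Space115 L η lev₀ lev₁ Dc → NegSize L η lev₀ 3 𝔸} {A' : Space115 L η lev₀ lev₁ Dc} {Θ : ℝ} (hΘ0 : 0 ≤ Θ)
    (hΘ : ∀ b : Bond d Pd, ∑ b' : Bond d Pd, levWeight L η lev₀ 3 b / levWeight L η lev₀ 3 b' * ‖kernel (fderiv ℂ Φ A') b' b‖ ≤ Θ) :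
    ‖pullCur ρ τ Φ cur A'‖ ≤ ‖ρ‖ * ‖τ‖ * Θ * ‖cur (Φ A')‖ :=
  norm_transCur_le ρ τ _ hΘ0 hΘ _

/-- **THE (98)-FORM FOR A PULLED-BACK GROUP**: if `‖cur(Y)‖₍₋₃₎ ≤ C‖Y‖²` on `‖Y‖ < R`, `Φ` maps the ball `‖A′‖ < R′` into `‖·‖ < R` with
`‖Φ A′‖ ≤ ℓ‖A′‖`, and the kernels of `Φ′(A′)` have weighted columns `≤ Θ` there, then `‖(Φ′(A′))ᵗcur(Φ A′)‖₍₋₃₎ ≤ ‖ρ‖‖τ‖ΘCℓ²·‖A′‖²` on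
`‖A′‖ < R′`. [cite: Balaban1985Variational, (98) p.293, (90) p.291] -/
theorem norm_pullCur_le_sq (ρ : (𝔸 →L[ℂ] ℂ) →L[ℂ] 𝔸) (τ : 𝔸 →L[ℂ] ℂ) {Φ : Space115 L η lev₀ lev₁ Dc → Space115 L η lev₀ lev₁ Dc}
    {cur : Space115 L η lev₀ lev₁ Dc → NegSize L η lev₀ 3 𝔸} {R R' Θ C ℓ : ℝ} (hΘ0 : 0 ≤ Θ) (hC : 0 ≤ C)
    (hq : ∀ Y : Space115 L η lev₀ lev₁ Dc, ‖Y‖ < R → ‖cur Y‖ ≤ C * ‖Y‖ ^ 2)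
    (hR : ∀ A' : Space115 L η lev₀ lev₁ Dc, ‖A'‖ < R' → ‖Φ A'‖ < R)
    (hℓ : ∀ A' : Space115 L η lev₀ lev₁ Dc, ‖A'‖ < R' → ‖Φ A'‖ ≤ ℓ * ‖A'‖)
    (hΘ : ∀ A' : Space115 L η lev₀ lev₁ Dc, ‖A'‖ < R' →
      ∀ b : Bond d Pd, ∑ b' : Bond d Pd, levWeight L η lev₀ 3 b / levWeight L η lev₀ 3 b' * ‖kernel (fderiv ℂ Φ A') b' b‖ ≤ Θ)
    (A' : Space115 L η lev₀ lev₁ Dc) (hA' : ‖A'‖ < R') :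
    ‖pullCur ρ τ Φ cur A'‖ ≤ ‖ρ‖ * ‖τ‖ * Θ * C * ℓ ^ 2 * ‖A'‖ ^ 2 := by
  have hℓA : 0 ≤ ℓ * ‖A'‖ := (norm_nonneg _).trans (hℓ A' hA')
  calc ‖pullCur ρ τ Φ cur A'‖ ≤ ‖ρ‖ * ‖τ‖ * Θ * ‖cur (Φ A')‖ := norm_pullCur_le ρ τ hΘ0 (hΘ A' hA')
    _ ≤ ‖ρ‖ * ‖τ‖ * Θ * (C * ‖Φ A'‖ ^ 2) := by gcongr; exact hq _ (hR A' hA')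
    _ ≤ ‖ρ‖ * ‖τ‖ * Θ * (C * (ℓ * ‖A'‖) ^ 2) := by gcongr; exact hℓ A' hA'
    _ = ‖ρ‖ * ‖τ‖ * Θ * C * ℓ ^ 2 * ‖A'‖ ^ 2 := by ring

/-- **`Prop4Hyp` FOR A PULLED-BACK GROUP** (the slot structure of `B11Prop6Scheme`): under the hypotheses of `norm_pullCur_le_sq` with `Φ`
analytic on the ball `‖A′‖ < R′` and `cur` differentiable on `‖Y‖ < R`, `Prop4Hyp (pullCur ρ τ Φ cur) (‖ρ‖‖τ‖ΘCℓ²) R′`.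
[cite: Balaban1985Variational, Prop. 4 (98) pp.292–293] -/
theorem prop4Hyp_pullCur (ρ : (𝔸 →L[ℂ] ℂ) →L[ℂ] 𝔸) (τ : 𝔸 →L[ℂ] ℂ) {Φ : Space115 L η lev₀ lev₁ Dc → Space115 L η lev₀ lev₁ Dc}
    {cur : Space115 L η lev₀ lev₁ Dc → NegSize L η lev₀ 3 𝔸} {R R' Θ C ℓ : ℝ} (hΘ0 : 0 ≤ Θ) (hC : 0 ≤ C)
    (hq : ∀ Y : Space115 L η lev₀ lev₁ Dc, ‖Y‖ < R → ‖cur Y‖ ≤ C * ‖Y‖ ^ 2)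
    (hcur : DifferentiableOn ℂ cur {Y | ‖Y‖ < R})
    (hΦ : AnalyticOnNhd ℂ Φ {A' | ‖A'‖ < R'})
    (hR : ∀ A' : Space115 L η lev₀ lev₁ Dc, ‖A'‖ < R' → ‖Φ A'‖ < R)
    (hℓ : ∀ A' : Space115 L η lev₀ lev₁ Dc, ‖A'‖ < R' → ‖Φ A'‖ ≤ ℓ * ‖A'‖)
    (hΘ : ∀ A' : Space115 L η lev₀ lev₁ Dc, ‖A'‖ < R' →
      ∀ b : Bond d Pd, ∑ b' : Bond d Pd, levWeight L η lev₀ 3 b / levWeight L η lev₀ 3 b' * ‖kernel (fderiv ℂ Φ A') b' b‖ ≤ Θ) :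
    B11Prop6Scheme.Prop4Hyp (pullCur ρ τ Φ cur) (‖ρ‖ * ‖τ‖ * Θ * C * ℓ ^ 2) R' where
  quad Y hY := norm_pullCur_le_sq ρ τ hΘ0 hC hq hR hℓ hΘ Y hY
  differentiableOn := differentiableOn_pullCur ρ τ hΦ (fun A' hA' => hR A' hA') hcur

end Pullback

end Literature.MathematicalPhysics.QuantumFieldTheory.Balaban1983to89.B11Eq90Pullback

end
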